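import Literature.NumberTheory.EllipticCurves.AnticyclotomicSignedSelmerRelaxedEqualityReduction
import Literature.NumberTheory.EllipticCurves.AnticyclotomicSignedCompactSelmerTorsionFreeProofs
import HarnessLib

/-!
# Castella–Wan 2024, proof of Thm. 6.8 (MS p. 30): "(6.12) shows that `Sel^{±,rel}(K, 𝐓^ac)` has
# `Λ^ac`-rank one" — the rank count PROVED on the tree's carriers, and the named fact
# `castellaWan2024_proofThm68_selmerRel_le_selmerSgn` (INPUTS row G67) closed modulo SMALLER inputs

`Proofs`-style companion no. 2 of `AnticyclotomicSignedSelmerRelaxedEquality.lean` (named fact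
`castellaWan2024_proofThm68_selmerRel_le_selmerSgn`, INPUTS row G67 of the BSD cell `pub/bsd-wall/bsd-inputs`;
consumer: crux `AnticyclotomicEisensteinDivisibility`, stmt-BirchSwinnertonDyer-20727, `stub_namedFactsSS` conj. 7),
continuing `AnticyclotomicSignedSelmerRelaxedEqualityReduction.lean` (same seat, `bsd-input-cw24-lem67-thm68`).
THEOREMS ONLY (no definition, no named fact, no instance, no `sorry`). HONEST FRAMING: the fact is NOT
discharged; this file removes from its remaining inputs everything that is module algebra or already a tree
theorem. No summit statement (Birch–Swinnerton-Dyer) is proved by this file.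

## The printed argument (accepted MS `paper:url-7157bd4f7b88`, proof of Thm. 6.8, MS p. 30 = journal p. 2624)

"Note that `E(K)[p] = 0` …, and hence `E(K_∞)[p^∞] = 0`, which by [PR00, § 1.3.3] implies that the
`Λ^ac`-torsion submodule of `H¹(K, 𝐓^ac)` is trivial. Global duality yields the following exact sequence
(6.12) `0 → Sel^{str,rel}(K, 𝐓^ac) → Sel^{±,rel}(K, 𝐓^ac) —loc_𝔭→ H¹_±(K_𝔭, 𝐓^ac) → X^{rel,str} → X^{±,str} → 0`.
Since `H¹_±(K_𝔭, 𝐓^ac) ≃ Λ^ac` (see Proposition 3.8), … if … `Sel^{str,rel}(K, 𝐓^ac) [is] `Λ^ac`-torsion,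
then (6.12) shows that `Sel^{±,rel}(K, 𝐓^ac)` has `Λ^ac`-rank one, and since by Lemma 4.7 and Corollary 6.4
the submodule `Sel_±(K, 𝐓^ac) ⊂ Sel^{±,rel}(K, 𝐓^ac)` contains the non-torsion class `z^±_∞`, it follows
that `Sel_±(K, 𝐓^ac)` has rank one … either of the rank hypotheses in (i) or (ii) implies that both
`Sel_±(K, 𝐓^ac)` and `Sel^{±,rel}(K, 𝐓^ac)` have `Λ^ac`-rank one, and hence `Sel_±(K, 𝐓^ac) =
Sel^{±,rel}(K, 𝐓^ac)`, since the quotient … injects into `H¹(K_𝔭̄, 𝐓^ac)/H¹_±(K_𝔭̄, 𝐓^ac)`, which has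
trivial `Λ^ac`-torsion by Proposition 3.8."

The rank count is: `rank Sel^{±,rel} = rank ker(loc_𝔭) + rank im(loc_𝔭) ≤ 0 + rank H¹_±(K_𝔭, 𝐓^ac) = 1`
(kernel torsion, target free of rank one), and `rank Sel^{±,rel} ≥ rank Sel_± = 1` (the submodule; under
the hypotheses of Thm. 6.8 (i), which are the hypotheses of the named fact, `rank Sel_± = 1` is GIVEN, so
Lemma 4.7 / Cor. 6.4 are not needed for this inequality). This is §1–§2 below. Together with the tree's
theorem `selmerLambdaAdic.smul_eq_zero_imp_of_layers` ([PR00, §1.3.3] on the carriers, file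
`AnticyclotomicSignedCompactSelmerTorsionFreeProofs`, fed by `E(K_∞)[p] = 0` = the named fact
`iovitaPollack2006_lemma21_noPTorsion_top`, itself PROVED in the tree on the Summit side,
`…Theorems.UniversalToricDescentSignedSettingNoPTorsion.iovitaPollack2006_lemma21_noPTorsion_top_holds`) and
the first reduction `castellaWan2024_proofThm68_selmerRel_le_selmerSgn_of_rankOne_of_saturated`, §3 closes
the named fact MODULO: (a) "`Sel^{str,rel}(K, 𝐓^ac)` is `Λ^ac`-torsion", read with print's definition
`Sel^{str,rel} = ker(loc_𝔭 | Sel^{±,rel})` ((6.12); the tree's `loc_𝔭` is `locSignedAt`, flag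
`str-vs-loc-zero`: no `PCond.str` enters); (b) "`H¹_±(K_𝔭, 𝐓^ac) ≃ Λ^ac`" in the currency of the EXISTING
sibling fact `castellaWan2024_sec61_localSignedLambdaAdic_free_rank_one` (§6.1 / Prop. 3.11; taken as the
hypothesis `(h : that fact)`, not restated); (c) the saturation of `Sel_±` in `Sel^{±,rel}` (Prop. 3.8 at
`𝔭̄` + the injection of the quotient — unchanged from the first reduction); and the tree's standing
hypothesis `IsNonsplitIn κ 𝔭` (flag `localize-nonsplit`, needed to FORM `loc_𝔭`; true in the `Setting`).

## Contents

* §1 (pure algebra, commutative domain `R`) `finrank_eq_one_of_torsion_ker_of_finrank_eq_one`: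
  `N ↪ M —f→ P` linear, `finrank N = 1`, `ker f` torsion (elementwise), `finrank P = 1` ⟹ `finrank M = 1`
  (rank–nullity over a domain, `rank_quotient_add_rank_of_isDomain`).
* §2 `finrank_selmerLambdaAdic_eq_one_of_torsion_locKer`: on the carriers, for level-condition families
  `𝓛₀ ≤ 𝓛` with `𝓛_v = ε` at a non-split `v ∋ p`: `finrank Sel^{𝓛₀} = 1`, `ker(loc_v | Sel^{𝓛})` torsion,
  `H¹_ε(K_v, 𝐓^ac)` free of rank one ⟹ `finrank Sel^{𝓛} = 1` (`loc_v = locSignedAt`, `Λ`-linear by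
  `locSignedAt_smul`; the inclusion is `Λ`-linear because both structures are the truncated action `tsmul`).
* §3 `castellaWan2024_proofThm68_selmerRel_le_selmerSgn_of_torsion_locKer_of_saturated`: the named fact from
  `IsNonsplitIn κ 𝔭`, `iovitaPollack2006_lemma21_noPTorsion_top`, (a), (b) =
  `castellaWan2024_sec61_localSignedLambdaAdic_free_rank_one`, (c).

References: [CastellaWan2023] proof of Thm. 6.8 (MS p. 30), (6.12), Prop. 3.8 and Prop. 3.11 (MS p. 15),
§6.1 (MS p. 25), Def. 5.1 (MS p. 23); arXiv:1607.02019v3 Lemma 5.9 (held TeX p. 20); [PerrinRiou1995Asterisque]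
§1.3.3 and [IovitaPollack2006] Lemma 2.1 (both cited through Castella–Wan, MS p. 30).
-/

noncomputable section

open scoped Classical

open PowerSeries NumberField IsDedekindDomain Field
open Literature.NumberTheory.EllipticCurves Literature.NumberTheory.GaloisRepresentations
open Literature.NumberTheory.EllipticCurves.ModularForms Literature.NumberTheory.EllipticCurves.Castella2018

universe u v

namespace Literature.NumberTheory.EllipticCurves.AcSigned

/-! ## §1 Rank one from a torsion kernel and a rank-one target (pure algebra over a domain) -/

section RankCount

variable {R : Type*} [CommRing R] [IsDomain R] {M N P : Type v} [AddCommGroup M] [Module R M]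
  [AddCommGroup N] [Module R N] [AddCommGroup P] [Module R P]

/-- **The rank count of (6.12).** Over a commutative domain `R`: if `i : N → M` is an injective linear map
from a module with `finrank_R N = 1`, and `f : M → P` is a linear map whose kernel consists of torsion
elements (`f x = 0 ⟹ r • x = 0` for some `r ≠ 0`) into a module with `finrank_R P = 1`, then
`finrank_R M = 1`: indeed `rank M = rank (M ⧸ ker f) + rank (ker f) = rank (im f) + 0 ≤ rank P = 1`
(rank–nullity over a domain) and `rank M ≥ rank N = 1`. No finiteness hypothesis.
[cite: CastellaWan2023, proof of Thm. 6.8 (MS p. 30), "(6.12) shows that `Sel^{±,rel}(K, 𝐓^ac)` has `Λ^ac`-rank one"] -/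
theorem finrank_eq_one_of_torsion_ker_of_finrank_eq_one (i : N →ₗ[R] M) (hi : Function.Injective i)
    (hN : Module.finrank R N = 1) (f : M →ₗ[R] P)
    (hker : ∀ x : M, f x = 0 → ∃ r : R, r ≠ 0 ∧ r • x = 0) (hP : Module.finrank R P = 1) :
    Module.finrank R M = 1 := by
  have hN' : Module.rank R N = 1 := Cardinal.toNat_eq_one.1 hN
  have hP' : Module.rank R P = 1 := Cardinal.toNat_eq_one.1 hP
  -- the kernel is torsion, hence of rank zero
  have hk : Module.rank R (LinearMap.ker f) = 0 := by
    rw [rank_eq_zero_iff_isTorsion]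
    intro x
    obtain ⟨r, hr, hrx⟩ := hker x.1 (LinearMap.mem_ker.1 x.2)
    exact ⟨⟨r, mem_nonZeroDivisors_of_ne_zero hr⟩, Subtype.ext hrx⟩
  -- `rank M = rank (M ⧸ ker f) + rank (ker f) = rank (range f) ≤ rank P = 1`
  have hle : Module.rank R M ≤ 1 := by
    rw [← rank_quotient_add_rank_of_isDomain (LinearMap.ker f), hk, add_zero, f.quotKerEquivRange.rank_eq,
      ← hP']
    exact Submodule.rank_le _
  -- `rank M ≥ rank N = 1`
  have hge : 1 ≤ Module.rank R M := hN' ▸ i.rank_le_of_injective hi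
  exact Cardinal.toNat_eq_one.2 (le_antisymm hle hge)

end RankCount

/-! ## §2 The rank count on the compact carriers: `finrank Sel^{𝓛}(K, 𝐓^ac) = 1` -/

section Carriers

variable {K : Type u} [Field K] [NumberField K] {W : WeierstrassCurve K} {p : ℕ} [Fact p.Prime]
  {κ : ZpExtension K p} {γ : absoluteGaloisGroup K}

/-- **"(6.12) shows that `Sel^{±,rel}(K, 𝐓^ac)` has `Λ^ac`-rank one"**, on the tree's carriers and for any
two families of level conditions `𝓛₀, 𝓛` above `p` with `Sel^{𝓛₀}(K, 𝐓^ac) ≤ Sel^{𝓛}(K, 𝐓^ac)` and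
`𝓛_v = ε` at a prime `v ∋ p` that does not split in `K_∞` (`IsNonsplitIn`, so that `loc_v = locSignedAt :
Sel^{𝓛}(K, 𝐓^ac) → H¹_ε(K_v, 𝐓^ac)` is defined; local generator `γ_v` matching `γ`): IF `finrank_Λ Sel^{𝓛₀} =
1` (print: `rank Sel_± = 1`, hypothesis (i) of Thm. 6.8), every element of `ker(loc_v | Sel^{𝓛})` is
`Λ`-torsion (print: "`Sel^{str,rel}(K, 𝐓^ac)` [is] `Λ^ac`-torsion", `Sel^{str,rel} = ker loc_𝔭` by (6.12)),
and `H¹_ε(K_v, 𝐓^ac)` is free of rank one (print: "`H¹_±(K_𝔭, 𝐓^ac) ≃ Λ^ac` (see Proposition 3.8)",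
`localSignedLambdaAdic.IsFreeRankOne`), THEN `finrank_Λ Sel^{𝓛}(K, 𝐓^ac) = 1`. All structures are the
constructed ones (`selmerLambdaAdic.moduleOfGen hγ`, `localSignedLambdaAdic.moduleOfGen`); `loc_v` is
`Λ`-linear for them (`locSignedAt_smul`) and so is the inclusion (both are the truncated action `tsmul`).
[cite: CastellaWan2023, proof of Thm. 6.8 and (6.12) (MS p. 30), Prop. 3.8 (MS p. 15)] -/
theorem finrank_selmerLambdaAdic_eq_one_of_torsion_locKer (hγ : κ.IsTopGenerator γ)
    (v : HeightOneSpectrum (𝓞 K)) (hv : IsNonsplitIn κ v) {γv : absoluteGaloisGroup (v.adicCompletion K)}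
    (hγv : κ (resGalOfEmb (closureEmb (K := K) (v.adicCompletion K)) γv) = κ γ)
    {L₀ L : HeightOneSpectrum (𝓞 K) → PCond} {ε : ℤˣ} (hL : L v = .sgn ε)
    (hvp : ((p : ℕ) : 𝓞 K) ∈ v.asIdeal)
    (hle : selmerLambdaAdic W p κ γ L₀ ≤ selmerLambdaAdic W p κ γ L)
    (hrk₀ : letI := selmerLambdaAdic.moduleOfGen W p κ γ hγ L₀
      Module.finrank (IwasawaAlgebra p) (selmerLambdaAdic W p κ γ L₀) = 1)
    (hker : ∀ x : selmerLambdaAdic W p κ γ L, locSignedAt W p κ v hv γ γv hγv L ε hL hvp x = 0 →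
      ∃ g : IwasawaAlgebra p, g ≠ 0 ∧ (letI := selmerLambdaAdic.moduleOfGen W p κ γ hγ L; g • x) = 0)
    (hfree : localSignedLambdaAdic.IsFreeRankOne (W.baseChange (v.adicCompletion K)) p (localizeAt κ v hv) γv
      (isTopGenerator_localize_of_apply_eq p κ _ hv hγv hγ) ε) :
    letI := selmerLambdaAdic.moduleOfGen W p κ γ hγ L
    Module.finrank (IwasawaAlgebra p) (selmerLambdaAdic W p κ γ L) = 1 := by
  letI instL := selmerLambdaAdic.moduleOfGen W p κ γ hγ L
  letI instL₀ := selmerLambdaAdic.moduleOfGen W p κ γ hγ L₀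
  letI instH := localSignedLambdaAdic.moduleOfGen (W.baseChange (v.adicCompletion K)) p (localizeAt κ v hv)
    γv (isTopGenerator_localize_of_apply_eq p κ _ hv hγv hγ) ε
  -- both actions on the Selmer carriers are the truncated action `tsmul` on families (definitional)
  have hval : ∀ (g : IwasawaAlgebra p) (y : selmerLambdaAdic W p κ γ L), (g • y).1 = tsmul W p κ γ g y.1 :=
    fun _ _ ↦ rfl
  have hval₀ : ∀ (g : IwasawaAlgebra p) (y : selmerLambdaAdic W p κ γ L₀), (g • y).1 = tsmul W p κ γ g y.1 :=
    fun _ _ ↦ rfl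
  -- the `Λ`-linear inclusion `Sel^{𝓛₀} ↪ Sel^{𝓛}`
  -- (injectivity through `Subtype.mk.inj`, so that the kernel never compares the two membership predicates)
  let i : selmerLambdaAdic W p κ γ L₀ →ₗ[IwasawaAlgebra p] selmerLambdaAdic W p κ γ L :=
    { toFun := fun x ↦ ⟨x.1, hle x.2⟩
      map_add' := fun _ _ ↦ rfl
      map_smul' := fun g x ↦ Subtype.ext (by
        change (g • x).1 = (g • (⟨x.1, hle x.2⟩ : selmerLambdaAdic W p κ γ L)).1
        rw [hval₀, hval]) }
  have hi : Function.Injective i := fun x y h ↦ Subtype.ext (Subtype.mk.inj h)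
  -- the `Λ`-linear localisation `loc_v : Sel^{𝓛} → H¹_ε(K_v, 𝐓^ac)`
  let f : selmerLambdaAdic W p κ γ L →ₗ[IwasawaAlgebra p]
      localSignedLambdaAdic (W.baseChange (v.adicCompletion K)) p (localizeAt κ v hv) γv ε :=
    { toFun := locSignedAt W p κ v hv γ γv hγv L ε hL hvp
      map_add' := map_add _
      map_smul' := fun g x ↦ locSignedAt_smul W p κ v hv hγv hγ hL hvp g x }
  exact finrank_eq_one_of_torsion_ker_of_finrank_eq_one i hi hrk₀ f (fun x hx ↦ hker x hx) hfree.2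

end Carriers

/-! ## §3 The named fact modulo its printed inputs, second reduction -/

section Fact

variable {N : ℕ} [NeZero N] {W : WeierstrassCurve ℚ} [W.IsGloballyMinimal] {K : Type} [Field K]
  [NumberField K] {p : ℕ} [Fact p.Prime] {κ : ZpExtension K p} {𝔭 𝔭' : HeightOneSpectrum (𝓞 K)}

/-- **Castella–Wan's sentence "`Sel_±(K, 𝐓^ac) = Sel^{±,rel}(K, 𝐓^ac)`" (proof of Thm. 6.8, MS p. 30) — the
named fact `castellaWan2024_proofThm68_selmerRel_le_selmerSgn` (INPUTS row G67) — MODULO its printed inputs,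
second reduction.** Compared with `castellaWan2024_proofThm68_selmerRel_le_selmerSgn_of_rankOne_of_saturated`
the input `hA` ("`Sel^{±,rel}` torsion-free of rank one") is REPLACED by what print derives it from:
* `h𝔭 : IsNonsplitIn κ 𝔭` — one prime of `K_∞` above `𝔭` (true in the `Setting`, `p ∤ h_K`; the tree's
  standing hypothesis to form `loc_𝔭`, flag `localize-nonsplit`);
* `hE : iovitaPollack2006_lemma21_noPTorsion_top …` — "`E(K_∞)[p^∞] = 0`" (the EXISTING named fact; proved
  in the tree on the Summit side), which gives "[PR00, §1.3.3] the `Λ^ac`-torsion submodule of `H¹(K, 𝐓^ac)`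
  is trivial" on every `Sel^{𝓛}(K, 𝐓^ac)` by the tree theorem `selmerLambdaAdic.smul_eq_zero_imp_of_layers`;
* `hStrRel` — "`Sel^{str,rel}(K, 𝐓^ac)` [is] `Λ^ac`-torsion", with print's `Sel^{str,rel} = ker(loc_𝔭 |
  Sel^{±,rel})` ((6.12)): every element of `Sel^{ε, rel at 𝔭'}` killed by `locSignedAt` at `𝔭` is
  `Λ`-torsion — under the fact's binders and for every local generator `γ_𝔭` matching `γ` (the kernel does
  not depend on `γ_𝔭`). NOT proved here: in print it is a consequence of the rank hypotheses via (6.13),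
  Cor. 6.4 and Lemma 6.7 ("the other implication … is similar"), none of which the tree has as theorems;
* `hH` — "`H¹_±(K_𝔭, 𝐓^ac) ≃ Λ^ac` (see Proposition 3.8)": the EXISTING sibling fact
  `castellaWan2024_sec61_localSignedLambdaAdic_free_rank_one` (§6.1 with Prop. 3.11), as a hypothesis;
* `hC` — the saturation of `Sel_ε` in `Sel^{ε,rel at 𝔭'}` ("the quotient injects into
  `H¹(K_𝔭̄, 𝐓^ac)/H¹_±(K_𝔭̄, 𝐓^ac)`, which has trivial `Λ^ac`-torsion by Proposition 3.8"), unchanged.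
Then `rank Sel^{ε,rel} = 1` by `finrank_selmerLambdaAdic_eq_one_of_torsion_locKer` (with `rank Sel_ε = 1`
from the fact's own hypotheses) and the first reduction applies. This closes INPUTS row G67 MODULO
`hStrRel ∧ hH ∧ hC` (and the two standing inputs `h𝔭`, `hE`); BSD is not proved by this.
[cite: CastellaWan2023, proof of Thm. 6.8 and (6.12) (MS p. 30), Prop. 3.8 / Prop. 3.11 (MS p. 15), §6.1 (MS p. 25)]
[cite: PerrinRiou1995Asterisque, §1.3.3 (cited through CastellaWan2023, MS p. 30)]
[cite: IovitaPollack2006, Lemma 2.1 (arXiv:math/0411496 p. 5)] -/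
theorem castellaWan2024_proofThm68_selmerRel_le_selmerSgn_of_torsion_locKer_of_saturated
    (h𝔭 : IsNonsplitIn κ 𝔭) (hE : iovitaPollack2006_lemma21_noPTorsion_top W K p κ 𝔭 𝔭')
    (hStrRel : ∀ (hS : Setting W K p κ 𝔭 𝔭') (ι : PadicAlgCl p ≃+* ℂ) {f : CuspForm (CongruenceSubgroup.Gamma0 N) 2}
      (_ : IsNewformOf W f), (W.conductorNorm ℤ : ℕ) = N → SatisfiesHeegnerHypothesis N K → 3 < p →
      (∀ (w : InfinitePlace K) (k : 𝓞 K), k ∈ 𝔭.asIdeal ↔ ‖ι.symm (w.embedding (k : K))‖ < 1) →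
      ∀ (γ : absoluteGaloisGroup K) (hγ : κ.IsTopGenerator γ) (ε : ℤˣ),
        (letI := selmerLambdaAdic.moduleOfGen (W.baseChange K) p κ γ hγ (fun _ ↦ PCond.sgn ε)
         Module.finrank (IwasawaAlgebra p) (selmerLambdaAdic (W.baseChange K) p κ γ (fun _ ↦ .sgn ε)) = 1) →
        X.HasRank (W.baseChange K) p κ ∅ (fun _ ↦ .sgn ε) hγ 1 →
        ∀ (γ𝔭 : absoluteGaloisGroup (𝔭.adicCompletion K))
          (hγ𝔭 : κ (resGalOfEmb (closureEmb (K := K) (𝔭.adicCompletion K)) γ𝔭) = κ γ)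
          (x : selmerLambdaAdic (W.baseChange K) p κ γ (PCond.at 𝔭' .rel (.sgn ε))),
          locSignedAt (W.baseChange K) p κ 𝔭 h𝔭 γ γ𝔭 hγ𝔭 (PCond.at 𝔭' .rel (.sgn ε)) ε
              (PCond.at_of_ne .rel (.sgn ε) (Ne.symm hS.ne)) hS.mem x = 0 →
            ∃ g : IwasawaAlgebra p, g ≠ 0 ∧
              (letI := selmerLambdaAdic.moduleOfGen (W.baseChange K) p κ γ hγ (PCond.at 𝔭' .rel (.sgn ε))
               g • x) = 0)
    (hH : castellaWan2024_sec61_localSignedLambdaAdic_free_rank_one W K p κ 𝔭 𝔭')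
    (hC : ∀ (_ : Setting W K p κ 𝔭 𝔭') (ι : PadicAlgCl p ≃+* ℂ) {f : CuspForm (CongruenceSubgroup.Gamma0 N) 2}
      (_ : IsNewformOf W f), (W.conductorNorm ℤ : ℕ) = N → SatisfiesHeegnerHypothesis N K → 3 < p →
      (∀ (w : InfinitePlace K) (k : 𝓞 K), k ∈ 𝔭.asIdeal ↔ ‖ι.symm (w.embedding (k : K))‖ < 1) →
      ∀ (γ : absoluteGaloisGroup K) (hγ : κ.IsTopGenerator γ) (ε : ℤˣ),
        (letI := selmerLambdaAdic.moduleOfGen (W.baseChange K) p κ γ hγ (fun _ ↦ PCond.sgn ε)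
         Module.finrank (IwasawaAlgebra p) (selmerLambdaAdic (W.baseChange K) p κ γ (fun _ ↦ .sgn ε)) = 1) →
        X.HasRank (W.baseChange K) p κ ∅ (fun _ ↦ .sgn ε) hγ 1 →
        ∀ (g : IwasawaAlgebra p), g ≠ 0 →
          ∀ x : selmerLambdaAdic (W.baseChange K) p κ γ (PCond.at 𝔭' .rel (.sgn ε)),
            (letI := selmerLambdaAdic.moduleOfGen (W.baseChange K) p κ γ hγ (PCond.at 𝔭' .rel (.sgn ε))
             (g • x).1) ∈ selmerLambdaAdic (W.baseChange K) p κ γ (fun _ ↦ .sgn ε) →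
            x.1 ∈ selmerLambdaAdic (W.baseChange K) p κ γ (fun _ ↦ .sgn ε)) :
    castellaWan2024_proofThm68_selmerRel_le_selmerSgn N W K p κ 𝔭 𝔭' := by
  refine castellaWan2024_proofThm68_selmerRel_le_selmerSgn_of_rankOne_of_saturated ?_ hC
  intro hS ι f hf hN hHeeg hp hι γ hγ ε hrk hX
  refine ⟨?_, ?_⟩
  · -- [PR00, §1.3.3] on the carriers, from `E(K_∞)[p] = 0`
    refine fun g x hgx ↦ selmerLambdaAdic.smul_eq_zero_imp_of_layers hγ (fun n P hfix hpP ↦ ?_) _ g x hgx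
    refine hE hS P (fun τ hτ ↦ hfix τ (κ.kerSubgroup_le_layerSubgroup n hτ)) ?_
    rw [← natCast_zsmul]
    exact hpP
  · -- the rank count of (6.12)
    obtain ⟨γ𝔭, hγ𝔭⟩ := exists_apply_resGalOfEmb_closureEmb_eq (p := p) (κ := κ) 𝔭 h𝔭 γ
    exact finrank_selmerLambdaAdic_eq_one_of_torsion_locKer hγ 𝔭 h𝔭 hγ𝔭
      (PCond.at_of_ne .rel (.sgn ε) (Ne.symm hS.ne)) hS.mem (selmerLambdaAdic_sgn_le_atRel γ ε) hrk
      (hStrRel hS ι hf hN hHeeg hp hι γ hγ ε hrk hX γ𝔭 hγ𝔭)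
      (hH hS N hN hHeeg hp 𝔭 hS.mem h𝔭 γ𝔭 (isTopGenerator_localize_of_apply_eq p κ _ h𝔭 hγ𝔭 hγ) ε)

end Fact

end Literature.NumberTheory.EllipticCurves.AcSigned

end
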